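import Mathlib.Data.Fintype.Powerset
import Literature.Combinatorics.Sahi2008.ProvedCases
import Literature.Combinatorics.Sahi2008.PushForward

/-!
# Sahi positivity of orders `≤ 3` does NOT imply order `4`: a 6-atom law (and its copy on the cube `2⁴`)

Support file of the master-family programme (crux `NoHeavyLowerTail`, stmt-CriticalPhenomena-4575; cell `prim-masterthm`,
seat P4 "induction on `k` through the FKG-lattice structure", unit `prim-masterthm-p4-g3`).  Vocabulary:
`SahiPositive μ n` (`E_n ≥ 0` for all nonnegative monotone `n`-families — Sahi's hierarchy `C_n` [Sahi2008, Conj. 5;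
LiebSahi2021, Conj. 1.1]; `C_{n+1} ⇒ C_n` for probability weights, `SahiPositive.of_succ`), its reduction to indicators
of up-sets `sahiPositive_iff_indicators` [LiebSahi2021, Lemma 2.2], push-forwards `pushWeight` / `SahiPositive.of_pushWeight`.

THE QUESTION this file settles (P4's brief: "state the inductive step `E_k (∧ Harris) ⇒ E_{k+1}` as a typed lemma and either
prove it or produce the exact obstruction instance").  Every `k → k+1` step landed so far for PRODUCT measures
(`SahiMasterFamily{ComparableStep, PrincipalDomination, ResidualStep, MeetStratum, TotalMeetStratum}`) uses the product
structure of the measure, not merely lower-order Sahi positivity of the SAME law.  Could lower-order positivity of the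
law alone carry the step — is `C_4` a consequence of `C_1 ∧ C_2 ∧ C_3` as properties of a weight on a finite poset?
NO:

* `SahiC3NotC4.sahiPositive_mu6_three`, `SahiC3NotC4.not_sahiPositive_mu6_four`: on the six-point poset
  `P6 = {⊥ < m₀, m₁, m₂, m₃ < ⊤}` (four pairwise incomparable middle points) the probability weight
  `μ(⊥) = 3/9, μ(m_i) = 1/9, μ(⊤) = 2/9` is Sahi-positive of orders `1, 2, 3` — all `18³` ordered triples of its
  18 up-sets satisfy `E_3 ≥ 0`, an integer check by `decide` — while for the four up-sets `U_i = {⊤} ∪ {m_j : j ≠ i}`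
  `E_4(U_0,U_1,U_2,U_3) = −85/6561 < 0` (`SahiC3NotC4.sahiE_four_mu6_bad`).
* `exists_sahiPositive_three_not_four`: pushed forward along the monotone map `⊥ ↦ ∅, m_i ↦ {i}, ⊤ ↦ {0,1,2,3}`
  this is the law `⅓·δ_∅ + (1/9)·Σ_i δ_{{i}} + (2/9)·δ_{[4]}` on the Boolean lattice `2⁴ = Finset (Fin 4)`, Sahi-positive of
  orders `2` and `3` but not `4`; the violating quadruple is `(x_j ∨ x_k ∨ x_l)_{ {j,k,l} = [4]∖{i} }`.

So in Sahi's hierarchy the orders do not imply each other upward even two at a time: `C_2 ∧ C_3 ⇏ C_4`, exactly as positive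
association does not imply `C_3` ([cite: Kahn2022, Cor 4 and p.3]: the Doyle–Fishburn–Shepp fixed-point law
`⅓δ_∅ + ⅙Σδ_{{i}} + ⅙δ_{[3]}` on `2³`; tree `SahiMasterFamilyAssocNotC3`, `Kahn2022.exists_isPositivelyAssociated_sahiE3_neg_kahn`)
— the present law is the order-4 member of the same shape one dimension up.  CONSEQUENCE for the master-family induction on `k`:
any proof of the `k = 3 → 4` step must use more of the measure than `C_{≤3}` of the law on the algebra generated by the events
(the product / FKG structure enters essentially); contrast `SahiMasterFamilyTotalMeetStratum`, by which `C_{≤3} ⇒ C_k` for every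
`k` DOES hold for an arbitrary probability weight on families having a member that contains the meet of the others — on the cube
`2³` every 4-family of up-sets has such a member, so the first non-collapse needs a 6-point poset / the cube `2⁴`.
HONEST FRAMING: a no-go about hypotheses; `μ` is not FKG (not even a lattice), and nothing here bears on `C_3`, `C_4` for FKG or
product measures, which remain OPEN [Sahi2008, Conj. 5; Kahn2022, Conj. 5].  The witness was found by this seat's exact
search (2026-08-20; first on the lattice `2×2×3`, then recognised as a law on its 6-point sub-poset); new, [this work].
-/

namespace Summit.CriticalPhenomena.PercolationContinuityZ3.Theorems

open Finset
open Literature.Combinatorics.Sahi2008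
open Literature.Probability.LatticeModels (mass)

namespace SahiC3NotC4

/-! ### The six-point poset `P6 = {⊥ < m₀,…,m₃ < ⊤}` -/

/-- The carrier: a bottom, four middle points, a top. [this work] -/
inductive P6 : Type
  | bot : P6
  | mid : Fin 4 → P6
  | top : P6
  deriving DecidableEq

namespace P6

/-- The six points, listed. [this work] -/
instance : Fintype P6 where
  elems := {bot, mid 0, mid 1, mid 2, mid 3, top}
  complete := by
    intro x
    rcases x with _ | i | _
    · simp
    · fin_cases i <;> simp
    · simp

/-- The order: `⊥` below everything, `⊤` above everything, the middle points pairwise incomparable. [this work] -/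
instance : LE P6 := ⟨fun a b => a = bot ∨ b = top ∨ a = b⟩

/-- `≤` on `P6` is decidable. [this work] -/
instance decLE : DecidableRel (α := P6) (· ≤ ·) :=
  fun a b => inferInstanceAs (Decidable (a = bot ∨ b = top ∨ a = b))

/-- Unfolding `≤` on `P6`. [this work] -/
theorem le_def (a b : P6) : a ≤ b ↔ a = bot ∨ b = top ∨ a = b := Iff.rfl

/-- `P6` is a partial order (a poset of height 2 with four incomparable middle points). [this work] -/
instance : PartialOrder P6 where
  le := (· ≤ ·)
  le_refl a := Or.inr (Or.inr rfl)
  le_trans a b c hab hbc := by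
    rw [le_def] at hab hbc ⊢
    rcases hab with rfl | rfl | rfl
    · exact Or.inl rfl
    · rcases hbc with h | rfl | rfl
      · exact absurd h (by simp)
      · exact Or.inr (Or.inl rfl)
      · exact Or.inr (Or.inl rfl)
    · exact hbc
  le_antisymm a b hab hba := by
    rw [le_def] at hab hba
    rcases hab with rfl | rfl | rfl
    · rcases hba with h | h | h
      · exact h.symm
      · exact absurd h (by simp)
      · exact h.symm
    · rcases hba with h | h | h
      · exact absurd h (by simp)
      · exact h
      · exact h.symm
    · rfl

/-- `Finset.univ` of `P6`, as the explicit six-element set. [this work] -/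
theorem univ_eq : (univ : Finset P6) = {bot, mid 0, mid 1, mid 2, mid 3, top} := rfl

/-- Sums over `P6`, term by term. [this work] -/
theorem sum_univ (f : P6 → ℝ) :
    ∑ x, f x = f bot + f (mid 0) + f (mid 1) + f (mid 2) + f (mid 3) + f top := by
  rw [univ_eq]
  simp only [sum_insert, mem_insert, mem_singleton, reduceCtorEq, mid.injEq, Fin.reduceEq, or_self,
    not_false_eq_true, sum_singleton]
  ring

end P6

open P6

/-! ### The weight `μ = (3; 1,1,1,1; 2)/9` and the up-sets of `P6` -/

/-- Integer masses: `⊥ ↦ 3`, each middle point `↦ 1`, `⊤ ↦ 2` (total `9`). [this work] -/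
def wt : P6 → ℕ
  | .bot => 3
  | .mid _ => 1
  | .top => 2

/-- The probability weight `μ = wt/9` on `P6`. [this work] -/
noncomputable def mu6 : P6 → ℝ := fun x => (wt x : ℝ) / 9

/-- `μ ≥ 0`. [this work] -/
theorem mu6_nonneg (x : P6) : 0 ≤ mu6 x := by
  unfold mu6; positivity

/-- `μ` is a probability weight. [this work] -/
theorem sum_mu6 : ∑ x, mu6 x = 1 := by
  rw [sum_univ]
  simp only [mu6, wt]
  norm_num

/-- Masses of sets under `μ` are the integer masses divided by `9`. [this work] -/
theorem mass_mu6 (A : Finset P6) : mass mu6 A = ((∑ x ∈ A, wt x : ℕ) : ℝ) / 9 := by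
  simp only [mass, mu6, Nat.cast_sum, Finset.sum_div]

/-- The 18 up-sets of `P6`: `∅`, `{⊤} ∪ M` for `M` any set of middle points, and everything. [this work] -/
def upList : Finset (Finset P6) :=
  ({(∅ : Finset P6),
    {top},
    {top, mid 0},
    {top, mid 1},
    {top, mid 2},
    {top, mid 3},
    {top, mid 0, mid 1},
    {top, mid 0, mid 2},
    {top, mid 0, mid 3},
    {top, mid 1, mid 2},
    {top, mid 1, mid 3},
    {top, mid 2, mid 3},
    {top, mid 0, mid 1, mid 2},
    {top, mid 0, mid 1, mid 3},
    {top, mid 0, mid 2, mid 3},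
    {top, mid 1, mid 2, mid 3},
    {top, mid 0, mid 1, mid 2, mid 3},
    {top, mid 0, mid 1, mid 2, mid 3, bot}} : Finset (Finset P6))

set_option maxRecDepth 100000 in
/-- **Enumeration of the up-sets of `P6`**: every upward closed subset is one of the 18 listed sets (kernel check by
`decide`, 64 candidates). [this work] -/
theorem upperSet_mem_upList :
    ∀ A : Finset P6, (∀ a b : P6, a ≤ b → a ∈ A → b ∈ A) → A ∈ upList := by
  decide

set_option maxRecDepth 100000 in
/-- **The `18³` integer inequalities**: for all up-sets `A, B, C` of `P6`, with `S_X = Σ_{x∈X} wt x`,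
`9·(S_A S_{B∩C} + S_B S_{A∩C} + S_C S_{A∩B}) ≤ 162·S_{A∩B∩C} + S_A S_B S_C`, i.e. `729·E_3(1_A,1_B,1_C) ≥ 0` for the law
`wt/9` (kernel check by `decide`). [this work] -/
theorem upList_E3_nonneg_nat :
    ∀ A ∈ upList, ∀ B ∈ upList, ∀ C ∈ upList,
      9 * ((∑ x ∈ A, wt x) * (∑ x ∈ B ∩ C, wt x) + (∑ x ∈ B, wt x) * (∑ x ∈ A ∩ C, wt x) +
            (∑ x ∈ C, wt x) * (∑ x ∈ A ∩ B, wt x)) ≤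
        162 * (∑ x ∈ A ∩ B ∩ C, wt x) + (∑ x ∈ A, wt x) * (∑ x ∈ B, wt x) * (∑ x ∈ C, wt x) := by
  decide

/-- **`C_3` holds for `μ`**: the weight `(3;1,1,1,1;2)/9` on `P6` is Sahi-positive of order `3`. [this work] -/
theorem sahiPositive_mu6_three : SahiPositive mu6 3 := by
  rw [sahiPositive_iff_indicators]
  intro U hU
  have hup : ∀ i, U i ∈ upList := fun i =>
    upperSet_mem_upList (U i) fun a b hab ha => hU i hab ha
  have hnat := upList_E3_nonneg_nat (U 0) (hup 0) (U 1) (hup 1) (U 2) (hup 2)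
  have hR : (9 : ℝ) * (((∑ x ∈ U 0, wt x : ℕ) : ℝ) * ((∑ x ∈ U 1 ∩ U 2, wt x : ℕ) : ℝ) +
        ((∑ x ∈ U 1, wt x : ℕ) : ℝ) * ((∑ x ∈ U 0 ∩ U 2, wt x : ℕ) : ℝ) +
        ((∑ x ∈ U 2, wt x : ℕ) : ℝ) * ((∑ x ∈ U 0 ∩ U 1, wt x : ℕ) : ℝ)) ≤
      162 * ((∑ x ∈ U 0 ∩ U 1 ∩ U 2, wt x : ℕ) : ℝ) +
        ((∑ x ∈ U 0, wt x : ℕ) : ℝ) * ((∑ x ∈ U 1, wt x : ℕ) : ℝ) * ((∑ x ∈ U 2, wt x : ℕ) : ℝ) := by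
    exact_mod_cast hnat
  rw [sahiE_three_apply]
  simp only [setInd_mul, ex_setInd, mass_mu6]
  linarith [hR]

/-- `C_2` (positive association) and `C_1` follow (`C_{n+1} ⇒ C_n` for probability weights). [this work] -/
theorem sahiPositive_mu6_two : SahiPositive mu6 2 :=
  sahiPositive_mu6_three.of_succ mu6_nonneg sum_mu6

/-! ### The violating quadruple `U_i = {⊤} ∪ {m_j : j ≠ i}` -/

/-- `U_i`: the top together with the three middle points other than `m_i` (an up-set of `P6`). [this work] -/
def bad (i : Fin 4) : Finset P6 := univ.filter fun x => x ≠ bot ∧ x ≠ mid i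

/-- Each `U_i` is an up-set. [this work] -/
theorem isUpperSet_bad (i : Fin 4) : IsUpperSet (bad i : Set P6) := by
  intro a b hab ha
  simp only [coe_filter, mem_univ, true_and, Set.mem_setOf_eq, bad] at ha ⊢
  rcases (le_def a b).1 hab with rfl | rfl | rfl
  · exact absurd rfl ha.1
  · exact ⟨by simp, by simp⟩
  · exact ha

/-- The integer masses of the `U_i` and of their intersections: `5`, `4` (pairs), `3` (triples), `2` (all four). [this work] -/
theorem wt_bad :
    (∀ i : Fin 4, ∑ x ∈ bad i, wt x = 5) ∧
    (∀ i j : Fin 4, i ≠ j → ∑ x ∈ bad i ∩ bad j, wt x = 4) ∧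
    (∀ i j k : Fin 4, i ≠ j → i ≠ k → j ≠ k → ∑ x ∈ bad i ∩ bad j ∩ bad k, wt x = 3) ∧
    ∑ x ∈ bad 0 ∩ bad 1 ∩ bad 2 ∩ bad 3, wt x = 2 := by
  refine ⟨by decide, by decide, by decide, by decide⟩

/-- **`E_4 < 0`**: `E_4(1_{U_0},1_{U_1},1_{U_2},1_{U_3}) = −85/6561` under `μ`. [this work] -/
theorem sahiE_four_mu6_bad : sahiE mu6 4 (fun i => setInd (bad i)) = -85 / 6561 := by
  have hf : (fun i => setInd (bad i) : Fin 4 → P6 → ℝ) =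
      ![setInd (bad 0), setInd (bad 1), setInd (bad 2), setInd (bad 3)] := by
    ext i x; fin_cases i <;> rfl
  obtain ⟨h1, h2, h3, h4⟩ := wt_bad
  rw [hf, sahiE_four]
  simp only [setInd_mul, ex_setInd, mass_mu6, h1,
    h2 0 1 (by decide), h2 0 2 (by decide), h2 0 3 (by decide), h2 1 2 (by decide), h2 1 3 (by decide),
    h2 2 3 (by decide), h3 0 1 2 (by decide) (by decide) (by decide), h3 0 1 3 (by decide) (by decide) (by decide),
    h3 0 2 3 (by decide) (by decide) (by decide), h3 1 2 3 (by decide) (by decide) (by decide), h4]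
  norm_num

/-- **`C_4` fails for `μ`.** [this work] -/
theorem not_sahiPositive_mu6_four : ¬ SahiPositive mu6 4 := by
  intro h
  have h4 := h (fun i => setInd (bad i)) (fun i x => setInd_nonneg _ _)
    (fun i => monotone_setInd (isUpperSet_bad i))
  rw [sahiE_four_mu6_bad] at h4
  norm_num at h4

/-- **`C_1 ∧ C_2 ∧ C_3 ⇏ C_4`** on the six-point poset `P6`: the probability weight `(3;1,1,1,1;2)/9` is Sahi-positive of
orders `2` and `3` but not `4`. [this work] -/
theorem sahiPositive_three_not_four_P6 :
    (∀ x, 0 ≤ mu6 x) ∧ ∑ x, mu6 x = 1 ∧ SahiPositive mu6 2 ∧ SahiPositive mu6 3 ∧ ¬ SahiPositive mu6 4 :=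
  ⟨mu6_nonneg, sum_mu6, sahiPositive_mu6_two, sahiPositive_mu6_three, not_sahiPositive_mu6_four⟩

/-! ### Transfer to the Boolean lattice `2⁴ = Finset (Fin 4)` -/

/-- The monotone embedding `toCube : P6 → 2⁴`: `⊥ ↦ ∅`, `m_i ↦ {i}`, `⊤ ↦ [4]`. [this work] -/
def toCube : P6 → Finset (Fin 4)
  | .bot => ∅
  | .mid i => {i}
  | .top => univ

/-- `toCube` is monotone. [this work] -/
theorem toCube_monotone : Monotone toCube := by
  intro a b hab
  rcases (le_def a b).1 hab with rfl | rfl | rfl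
  · exact empty_subset _
  · exact subset_univ _
  · exact le_rfl

/-- The increasing event "some coordinate other than `i` is open": `{S : ¬ S ⊆ {i}}` ⊆ `2⁴` — the up-set `x_j ∨ x_k ∨ x_l`,
`{j,k,l} = [4] ∖ {i}`. [this work] -/
def orSet (i : Fin 4) : Finset (Finset (Fin 4)) := univ.filter fun S => ¬ S ⊆ {i}

/-- `orSet i` is an up-set of `2⁴`. [this work] -/
theorem isUpperSet_orSet (i : Fin 4) : IsUpperSet (orSet i : Set (Finset (Fin 4))) := by
  intro S T hST hS
  simp only [orSet, coe_filter, mem_univ, true_and, Set.mem_setOf_eq] at hS ⊢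
  exact fun h => hS (hST.trans h)

/-- Pulling `orSet i` back along `toCube` gives `U_i`. [this work] -/
theorem mem_orSet_toCube_iff : ∀ (i : Fin 4) (x : P6), toCube x ∈ orSet i ↔ x ∈ bad i := by
  decide

/-- Hence `1_{orSet i} ∘ toCube = 1_{U_i}`. [this work] -/
theorem setInd_orSet_comp_toCube (i : Fin 4) : setInd (orSet i) ∘ toCube = setInd (bad i) := by
  funext x
  simp only [Function.comp_apply, setInd, mem_orSet_toCube_iff]

/-- **Sahi positivity of orders `≤ 3` does not imply order `4`, on the Boolean lattice `2⁴`.**  There is a probability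
weight on `Finset (Fin 4)` (namely `⅓δ_∅ + (1/9)Σ_i δ_{{i}} + (2/9)δ_{[4]}`, the push-forward of `(3;1,1,1,1;2)/9` along
`toCube`) which is Sahi-positive of orders `2` and `3` and NOT of order `4` (violated by the four events `x_j ∨ x_k ∨ x_l`).
Order-4 analogue of [cite: Kahn2022, Cor 4 and p.3] (positive association `⇏ C_3`, law `⅓δ_∅ + ⅙Σδ_{{i}} + ⅙δ_{[3]}` on `2³`).
[this work] -/
theorem exists_sahiPositive_three_not_four :
    ∃ μ : Finset (Fin 4) → ℝ,
      (∀ x, 0 ≤ μ x) ∧ ∑ x, μ x = 1 ∧ SahiPositive μ 2 ∧ SahiPositive μ 3 ∧ ¬ SahiPositive μ 4 := by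
  refine ⟨pushWeight mu6 toCube, fun x => pushWeight_nonneg mu6_nonneg toCube x, ?_,
    sahiPositive_mu6_two.of_pushWeight toCube_monotone, sahiPositive_mu6_three.of_pushWeight toCube_monotone, ?_⟩
  · rw [sum_pushWeight, sum_mu6]
  · intro h
    have h4 := h (fun i => setInd (orSet i)) (fun i x => setInd_nonneg _ _)
      (fun i => monotone_setInd (isUpperSet_orSet i))
    rw [sahiE_pushWeight] at h4
    have hfam : (fun i => setInd (orSet i) ∘ toCube) = fun i => setInd (bad i) := by
      funext i; exact setInd_orSet_comp_toCube i
    rw [hfam, sahiE_four_mu6_bad] at h4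
    norm_num at h4

end SahiC3NotC4

end Summit.CriticalPhenomena.PercolationContinuityZ3.Theorems
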